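import Summits.RiemannHypothesis.RiemannHypothesis.Theorems.GroundBartaGroundBartaFloorDefs
import Literature.NumberTheory.LFunctions.WeilThetaPhiMellin
import Literature.NumberTheory.LFunctions.WeilWindowSuzukiProofs
import HarnessLib

/-!
# The window image of the even theta vector is square-integrable on the window
(crux GroundBartaFloor, line `phi_window_supersolution`, stub imageMemLp)

For `a > 0` the window image `T_a = −2ϖ_a cosh(t/2) + P_a + A_a` (`groundThetaImage a` of
`GroundBartaGroundBartaFloorDefs.lean`) satisfies `𝟙_{(−a,a)} T_a ∈ L²(ℝ)`.

* The polar part is continuous, hence bounded on the window.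
* The prime layer `P_a(t) = Σ_n Λ(n) n^{-1/2} (R_a(t − log n) + R_a(t + log n))` is bounded on
  `|t| ≤ b` for every `b`, and measurable: `0 ≤ R_a ≤ Φ ≤ C e^{9|x|/2 − πe^{2|x|}}`
  (`weilThetaPhi_le_exp`) and `log n − b ≤ |t ± log n| ≤ log n + b` give the summable majorant
  `2C e^{5b} n⁶ e^{−πe^{−2b} n}`; measurability follows from the pointwise convergence of the
  measurable partial sums.
* The archimedean layer `A_a(t) = ∫ R_a(s) w(|t − s|) ds` is measurable (parametric Bochner integral
  with jointly measurable integrand) and, on the window,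
  `0 ≤ A_a(t) ≤ K₁ (a − t)^{−1/4} + K₂ (a + t)^{−1/4}`: by `w(r) ≤ e^{r/2}/(2r)`
  (`weilArchDensity_le_exp_half_div`) and the weighted AM–GM inequality
  `(s − a)^{3/4} (a − t)^{1/4} ≤ s − t`, the integrand is dominated by
  `(C/2) e^{a/2} · e^{−(s−a)} (s − a)^{−3/4} · (a − t)^{−1/4}`, a translate of Euler's `Γ(1/4)`
  integrand (`Real.GammaIntegral_convergent`); finally `(a ∓ t)^{−1/4} ∈ L²(−a, a)`.
This is the even twin of `OddSectorOddBartaFloorImageMemLp.lean` (same kernel `w`, tail `Φ` instead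
of `−Φ′`); everything proved here is folklore real analysis.
-/

set_option linter.dupNamespace false

noncomputable section

open Set MeasureTheory Filter Complex
open scoped Real Topology ComplexConjugate ArithmeticFunction.vonMangoldt ENNReal

namespace Summit.RiemannHypothesis.RiemannHypothesis.Theorems.GroundBartaFloor

open Literature.NumberTheory.LFunctions

/-! ## The envelope of `Φ` -/

/-- **The envelope of `Φ` with a positive constant**: `Φ(t) ≤ C e^{9|t|/2 − πe^{2|t|}}` with `C > 0`
(`weilThetaPhi_le_exp`; positivity of `C` from `Φ(0) > 0`). [folklore] -/
theorem exists_pos_weilThetaPhi_le_exp :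
    ∃ C : ℝ, 0 < C ∧ ∀ t : ℝ, weilThetaPhi t ≤ C * rexp (9 / 2 * |t| - π * rexp (2 * |t|)) := by
  obtain ⟨C, hC⟩ := weilThetaPhi_le_exp
  have h0 := hC 0
  have hpos : 0 < C := by
    by_contra h
    push Not at h
    have : C * rexp (9 / 2 * |(0 : ℝ)| - π * rexp (2 * |(0 : ℝ)|)) ≤ 0 :=
      mul_nonpos_of_nonpos_of_nonneg h (Real.exp_pos _).le
    linarith [weilThetaPhi_pos 0]
  exact ⟨C, hpos, hC⟩

/-! ## The prime layer: a summable majorant, uniform on `|t| ≤ b` -/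

/-- Shifted decay of `Φ`: for `n ≥ 1`, `b ≥ 0` and `log n − b ≤ |x| ≤ log n + b`,
`Φ(x) ≤ C · n⁵ e^{5b} e^{−πe^{−2b} n}` (given the envelope with constant `C ≥ 0`). [folklore] -/
theorem weilThetaPhi_shift_le {C : ℝ} (hC0 : 0 ≤ C)
    (hC : ∀ t : ℝ, weilThetaPhi t ≤ C * rexp (9 / 2 * |t| - π * rexp (2 * |t|)))
    {b x : ℝ} {n : ℕ} (hn : 1 ≤ n) (hb : 0 ≤ b)
    (h1 : Real.log n - b ≤ |x|) (h2 : |x| ≤ Real.log n + b) :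
    weilThetaPhi x ≤ C * ((n : ℝ) ^ 5 * rexp (5 * b) * rexp (-(π * rexp (-(2 * b))) * n)) := by
  have hn' : (1 : ℝ) ≤ n := by exact_mod_cast hn
  have hL : rexp (Real.log n) = n := Real.exp_log (by linarith)
  have hL0 : 0 ≤ Real.log n := Real.log_nonneg hn'
  have key : (n : ℝ) ^ 5 * rexp (5 * b) * rexp (-(π * rexp (-(2 * b))) * n) =
      rexp (5 * Real.log n + 5 * b + -(π * rexp (-(2 * b))) * n) := by
    rw [Real.exp_add, Real.exp_add,
      show (5 : ℝ) * Real.log n = ((5 : ℕ) : ℝ) * Real.log n by norm_num, Real.exp_nat_mul, hL]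
  rw [key]
  refine (hC x).trans (mul_le_mul_of_nonneg_left (Real.exp_le_exp.2 ?_) hC0)
  have h3 : rexp (2 * (Real.log n - b)) ≤ rexp (2 * |x|) := Real.exp_le_exp.2 (by linarith)
  rw [show (2 : ℝ) * (Real.log n - b) = Real.log n + Real.log n + -(2 * b) by ring, Real.exp_add,
    Real.exp_add, hL] at h3
  have h4 : (1 : ℝ) * (n * rexp (-(2 * b))) ≤ n * (n * rexp (-(2 * b))) :=
    mul_le_mul_of_nonneg_right hn' (by positivity)
  have h5 : π * (n * rexp (-(2 * b))) ≤ π * rexp (2 * |x|) :=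
    mul_le_mul_of_nonneg_left (by linarith) Real.pi_pos.le
  have h6 : 0 ≤ |x| := abs_nonneg x
  nlinarith

/-- The `n`-th term of the prime layer is dominated, uniformly on `|t| ≤ b`, by the summable
sequence `2C e^{5b} n⁶ e^{−πe^{−2b} n}`. [folklore] -/
theorem abs_groundPrimeTerm_le {C : ℝ} (hC0 : 0 ≤ C)
    (hC : ∀ t : ℝ, weilThetaPhi t ≤ C * rexp (9 / 2 * |t| - π * rexp (2 * |t|)))
    (a : ℝ) {b t : ℝ} (ht : |t| ≤ b) (n : ℕ) :
    |(Λ n : ℝ) / Real.sqrt n * (groundThetaTail a (t - Real.log n) + groundThetaTail a (t + Real.log n))| ≤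
      2 * C * rexp (5 * b) * ((n : ℝ) ^ 6 * rexp (-(π * rexp (-(2 * b))) * n)) := by
  rcases Nat.eq_zero_or_pos n with rfl | hn
  · simp
  have hn' : (1 : ℝ) ≤ n := by exact_mod_cast hn
  have hb : 0 ≤ b := (abs_nonneg t).trans ht
  have hL0 : 0 ≤ Real.log n := Real.log_nonneg hn'
  obtain ⟨ht1, ht2⟩ := abs_le.1 ht
  have hc0 : 0 ≤ (Λ n : ℝ) / Real.sqrt n :=
    div_nonneg ArithmeticFunction.vonMangoldt_nonneg (Real.sqrt_nonneg _)
  have hc1 : (Λ n : ℝ) / Real.sqrt n ≤ n :=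
    (div_le_self ArithmeticFunction.vonMangoldt_nonneg (Real.one_le_sqrt.2 hn')).trans
      (ArithmeticFunction.vonMangoldt_le_log.trans (Real.log_le_self (by linarith)))
  have h1 := weilThetaPhi_shift_le hC0 hC (x := t - Real.log n) hn hb
    (by linarith [neg_le_abs (t - Real.log n)])
    ((abs_sub _ _).trans (by rw [abs_of_nonneg hL0]; linarith))
  have h2 := weilThetaPhi_shift_le hC0 hC (x := t + Real.log n) hn hb
    (by linarith [le_abs_self (t + Real.log n)])
    ((abs_add_le _ _).trans (by rw [abs_of_nonneg hL0]; linarith))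
  rw [abs_mul, abs_of_nonneg hc0]
  set E : ℝ := (n : ℝ) ^ 5 * rexp (5 * b) * rexp (-(π * rexp (-(2 * b))) * n) with hE
  have hE0 : 0 ≤ E := by positivity
  calc _ ≤ (n : ℝ) * (C * E + C * E) :=
        mul_le_mul hc1 ((abs_add_le _ _).trans (add_le_add ((abs_groundThetaTail_le _ _).trans h1)
          ((abs_groundThetaTail_le _ _).trans h2))) (abs_nonneg _) (Nat.cast_nonneg _)
    _ = _ := by rw [hE]; ring

/-- The majorant is summable. [folklore] -/
theorem summable_groundPrimeMajorant (C b : ℝ) :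
    Summable fun n : ℕ => 2 * C * rexp (5 * b) * ((n : ℝ) ^ 6 * rexp (-(π * rexp (-(2 * b))) * n)) :=
  (Real.summable_pow_mul_exp_neg_nat_mul 6 (by positivity)).mul_left _

/-- The prime layer converges absolutely at every `t`. [folklore] -/
theorem summable_groundPrimeTerm (a t : ℝ) : Summable fun n : ℕ =>
    (Λ n : ℝ) / Real.sqrt n * (groundThetaTail a (t - Real.log n) + groundThetaTail a (t + Real.log n)) := by
  obtain ⟨C, hC0, hC⟩ := exists_pos_weilThetaPhi_le_exp
  exact (summable_groundPrimeMajorant C |t|).of_norm_bounded fun n =>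
    (Real.norm_eq_abs _).trans_le (abs_groundPrimeTerm_le hC0.le hC a le_rfl n)

/-- Uniform bound of the prime layer on `|t| ≤ b`: there is `CP` with `|P_a(t)| ≤ CP` for `|t| ≤ b`.
[folklore] -/
theorem exists_abs_groundThetaPrimeLayer_le (a b : ℝ) :
    ∃ CP : ℝ, ∀ t : ℝ, |t| ≤ b → |groundThetaPrimeLayer a t| ≤ CP := by
  obtain ⟨C, hC0, hC⟩ := exists_pos_weilThetaPhi_le_exp
  refine ⟨∑' n : ℕ, 2 * C * rexp (5 * b) * ((n : ℝ) ^ 6 * rexp (-(π * rexp (-(2 * b))) * n)),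
    fun t ht => ?_⟩
  have h := tsum_of_norm_bounded (summable_groundPrimeMajorant C b).hasSum
    fun n => (Real.norm_eq_abs _).trans_le (abs_groundPrimeTerm_le hC0.le hC a ht n)
  rwa [Real.norm_eq_abs] at h

/-- The prime layer is measurable (pointwise limit of its measurable partial sums). [folklore] -/
theorem measurable_groundThetaPrimeLayer (a : ℝ) : Measurable (groundThetaPrimeLayer a) := by
  have hR := measurable_groundThetaTail a
  refine measurable_of_tendsto_metrizable (f := fun N t => ∑ n ∈ Finset.range N,
    (Λ n : ℝ) / Real.sqrt n * (groundThetaTail a (t - Real.log n) + groundThetaTail a (t + Real.log n)))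
    (fun N => Finset.measurable_sum _ fun n _ => by fun_prop) ?_
  exact tendsto_pi_nhds.2 fun t => (summable_groundPrimeTerm a t).hasSum.tendsto_sum_nat

/-! ## The archimedean layer -/

/-- The archimedean layer is measurable. [folklore] -/
theorem measurable_groundThetaArchLayer (a : ℝ) : Measurable (groundThetaArchLayer a) := by
  have hw : Measurable weilArchDensity := by
    unfold weilArchDensity
    exact (Real.continuous_exp.comp (continuous_id.div_const 2)).measurable.div
      (continuous_const.mul Real.continuous_sinh).measurable
  have hf : Measurable fun p : ℝ × ℝ => groundThetaTail a p.2 * weilArchDensity |p.1 - p.2| :=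
    ((measurable_groundThetaTail a).comp measurable_snd).mul
      (hw.comp (continuous_abs.measurable.comp (measurable_fst.sub measurable_snd)))
  exact (hf.stronglyMeasurable.integral_prod_right' (ν := volume)).measurable

/-- One-sided kernel majorant: for `a < s` and `−a < t < a`,
`Φ(s) w(s − t) ≤ (C/2) e^{a/2} · e^{−(s−a)} (s − a)^{−3/4} · (a − t)^{−1/4}` (envelope of `Φ` with
constant `C ≥ 0`, `w(r) ≤ e^{r/2}/(2r)` and the weighted AM–GM inequality). [folklore] -/
theorem groundKernel_le {C : ℝ} (hC0 : 0 ≤ C)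
    (hC : ∀ t : ℝ, weilThetaPhi t ≤ C * rexp (9 / 2 * |t| - π * rexp (2 * |t|)))
    {a s t : ℝ} (hs : a < s) (ht1 : -a < t) (ht2 : t < a) :
    weilThetaPhi s * weilArchDensity (s - t) ≤
      C / 2 * rexp (a / 2) * (rexp (-(s - a)) * (s - a) ^ (1 / 4 - 1 : ℝ)) *
        (a - t) ^ (-(1 / 4) : ℝ) := by
  have hd : 0 < s - a := sub_pos.2 hs
  have hδ : 0 < a - t := sub_pos.2 ht2
  have hst : 0 < s - t := by linarith
  have hE : rexp (9 / 2 * |s| - π * rexp (2 * |s|)) * rexp ((s - t) / 2) ≤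
      rexp (a / 2) * rexp (-(s - a)) := by
    rw [← Real.exp_add, ← Real.exp_add, abs_of_pos (by linarith : (0 : ℝ) < s)]
    refine Real.exp_le_exp.2 ?_
    have h5 : 3 * rexp (2 * s) ≤ π * rexp (2 * s) :=
      mul_le_mul_of_nonneg_right Real.pi_gt_three.le (Real.exp_pos _).le
    linarith [Real.add_one_le_exp (2 * s)]
  have hamgm := Real.geom_mean_le_arith_mean2_weighted (w₁ := 3 / 4) (w₂ := 1 / 4) (by norm_num)
    (by norm_num) hd.le hδ.le (by norm_num)
  have hD : (2 * (s - t))⁻¹ ≤ 2⁻¹ * ((s - a) ^ (1 / 4 - 1 : ℝ) * (a - t) ^ (-(1 / 4) : ℝ)) := by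
    rw [show (1 / 4 - 1 : ℝ) = -(3 / 4) by norm_num, Real.rpow_neg hd.le, Real.rpow_neg hδ.le,
      ← mul_inv, ← mul_inv]
    exact inv_anti₀ (by positivity) (by linarith)
  calc weilThetaPhi s * weilArchDensity (s - t)
      ≤ (C * rexp (9 / 2 * |s| - π * rexp (2 * |s|))) * (rexp ((s - t) / 2) / (2 * (s - t))) :=
        mul_le_mul (hC s) (weilArchDensity_le_exp_half_div hst)
          (weilArchDensity_pos hst).le (by positivity)
    _ = C * (rexp (9 / 2 * |s| - π * rexp (2 * |s|)) * rexp ((s - t) / 2)) *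
          (2 * (s - t))⁻¹ := by
        rw [div_eq_mul_inv]; ring
    _ ≤ C * (rexp (a / 2) * rexp (-(s - a))) *
          (2⁻¹ * ((s - a) ^ (1 / 4 - 1 : ℝ) * (a - t) ^ (-(1 / 4) : ℝ))) := by
        gcongr C * ?_ * ?_
    _ = _ := by ring

/-- Bound of the archimedean layer on the window:
`|A_a(t)| ≤ K₁ (a − t)^{−1/4} + K₂ (a + t)^{−1/4}` for `t ∈ (−a, a)`. [folklore] -/
theorem exists_abs_groundThetaArchLayer_le (a : ℝ) : ∃ K₁ K₂ : ℝ,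
    ∀ t ∈ Ioo (-a) a, |groundThetaArchLayer a t| ≤
      K₁ * (a - t) ^ (-(1 / 4) : ℝ) + K₂ * (a + t) ^ (-(1 / 4) : ℝ) := by
  obtain ⟨C, hC0', hC⟩ := exists_pos_weilThetaPhi_le_exp
  have hC0 : 0 ≤ C := hC0'.le
  set b0 : ℝ → ℝ := (Ioi (0 : ℝ)).indicator fun x => rexp (-x) * x ^ (1 / 4 - 1 : ℝ) with hb0
  have hint : Integrable b0 :=
    (integrable_indicator_iff measurableSet_Ioi).2 (Real.GammaIntegral_convergent (by norm_num))
  have hI1 : Integrable fun s => b0 (s - a) := hint.comp_sub_right a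
  have hI2 : Integrable fun s => b0 (-s - a) := hI1.comp_neg
  have hnn : ∀ x, 0 ≤ b0 x := fun x =>
    Set.indicator_nonneg (fun y (hy : y ∈ Ioi (0 : ℝ)) => by
      have : (0 : ℝ) < y := hy
      positivity) x
  have hpos : ∀ x, 0 < x → b0 x = rexp (-x) * x ^ (1 / 4 - 1 : ℝ) := fun x hx =>
    indicator_of_mem (mem_Ioi.2 hx) _
  refine ⟨C / 2 * rexp (a / 2) * ∫ s, b0 (s - a), C / 2 * rexp (a / 2) * ∫ s, b0 (-s - a),
    fun t ht => ?_⟩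
  have hδ1 : 0 < a - t := by linarith [ht.2]
  have hδ2 : 0 < a + t := by linarith [ht.1]
  have key : ∀ s, ‖groundThetaTail a s * weilArchDensity |t - s|‖ ≤ C / 2 * rexp (a / 2) *
      (b0 (s - a) * (a - t) ^ (-(1 / 4) : ℝ) + b0 (-s - a) * (a + t) ^ (-(1 / 4) : ℝ)) := by
    intro s
    rw [Real.norm_eq_abs]
    rcases lt_or_ge a s with hs | hs
    · have hw : 0 < weilArchDensity |t - s| := weilArchDensity_pos (abs_pos.2 (by linarith))
      rw [groundThetaTail_of_not_mem (fun h => by linarith [h.2]), abs_mul,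
        abs_of_pos (weilThetaPhi_pos s), abs_of_pos hw,
        abs_sub_comm, abs_of_pos (by linarith : (0 : ℝ) < s - t), hpos _ (sub_pos.2 hs)]
      have := groundKernel_le hC0 hC hs ht.1 ht.2
      have h0 : 0 ≤ C / 2 * rexp (a / 2) * (b0 (-s - a) * (a + t) ^ (-(1 / 4) : ℝ)) := by
        have := hnn (-s - a); positivity
      linarith
    rcases lt_or_ge s (-a) with hs' | hs'
    · have hw : 0 < weilArchDensity |t - s| := weilArchDensity_pos (abs_pos.2 (by linarith))
      have := groundKernel_le hC0 hC (a := a) (s := -s) (t := -t) (by linarith) (by linarith [ht.2])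
        (by linarith [ht.1])
      rw [weilThetaPhi_neg, sub_neg_eq_add, sub_neg_eq_add] at this
      rw [groundThetaTail_of_not_mem (fun h => by linarith [h.1]), abs_mul,
        abs_of_pos (weilThetaPhi_pos s), abs_of_pos hw,
        abs_of_pos (by linarith : (0 : ℝ) < t - s), hpos _ (by linarith : (0 : ℝ) < -s - a),
        show t - s = -s + t by ring]
      have h0 : 0 ≤ C / 2 * rexp (a / 2) * (b0 (s - a) * (a - t) ^ (-(1 / 4) : ℝ)) := by
        have := hnn (s - a); positivity
      linarith
    · rw [groundThetaTail_of_mem ⟨hs', hs⟩, zero_mul, abs_zero]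
      have := hnn (s - a); have := hnn (-s - a); positivity
  have hmaj : Integrable fun s => C / 2 * rexp (a / 2) *
      (b0 (s - a) * (a - t) ^ (-(1 / 4) : ℝ) + b0 (-s - a) * (a + t) ^ (-(1 / 4) : ℝ)) :=
    ((hI1.mul_const _).add (hI2.mul_const _)).const_mul _
  calc |groundThetaArchLayer a t| = ‖∫ s, groundThetaTail a s * weilArchDensity |t - s|‖ :=
        (Real.norm_eq_abs _).symm
    _ ≤ ∫ s, C / 2 * rexp (a / 2) *
          (b0 (s - a) * (a - t) ^ (-(1 / 4) : ℝ) + b0 (-s - a) * (a + t) ^ (-(1 / 4) : ℝ)) :=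
        norm_integral_le_of_norm_le hmaj (Eventually.of_forall key)
    _ = _ := by
        rw [integral_const_mul, integral_add (hI1.mul_const _) (hI2.mul_const _),
          integral_mul_const, integral_mul_const]
        ring

/-- `u^{-1/4} ∈ L²` of the window when `u > 0` on it and `u^{-1/2}` is integrable on it. [folklore] -/
theorem memLp_rpow_neg_quarter' {a : ℝ} {u : ℝ → ℝ} (hu : Continuous u)
    (hpos : ∀ t ∈ Ioo (-a) a, 0 < u t)
    (hint : IntegrableOn (fun t => u t ^ (-(1 / 2) : ℝ)) (Ioo (-a) a)) :
    MemLp (fun t => u t ^ (-(1 / 4) : ℝ)) 2 (volume.restrict (Ioo (-a) a)) := by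
  refine (memLp_two_iff_integrable_sq (hu.measurable.pow_const _).aestronglyMeasurable).2
    (hint.congr ?_)
  filter_upwards [ae_restrict_mem measurableSet_Ioo] with t ht
  rw [← Real.rpow_two, ← Real.rpow_mul (hpos t ht).le]
  norm_num

/-! ## The window image is square-integrable on the window -/

/-- The image restricted to the open window is measurable. [folklore] -/
theorem measurable_groundThetaImage (a : ℝ) : Measurable (groundThetaImage a) := by
  have h : groundThetaImage a = fun t => -(2 * groundThetaPolarWeight a * Real.cosh (t / 2)) +
      groundThetaPrimeLayer a t + groundThetaArchLayer a t := funext fun t => rfl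
  rw [h]
  exact ((((Real.continuous_cosh.comp (continuous_id.div_const 2)).measurable.const_mul _).neg.add
    (measurable_groundThetaPrimeLayer a)).add (measurable_groundThetaArchLayer a))

/-- **Stub `imageMemLp`**: for `a > 0`, `𝟙_{(−a,a)} · T_a ∈ L²(ℝ)`, where
`T_a = groundThetaImage a = −2ϖ_a cosh(t/2) + P_a + A_a` is the window image of the even theta
vector (bounded polar and prime parts, logarithmically — here `O((a ∓ t)^{−1/4})` — singular
archimedean layer). [folklore] -/
theorem stub_groundImageMemLp :
    ∀ a : ℝ, 0 < a → MemLp (fun t => (Ioo (-a) a).indicator (groundThetaImage a) t) 2 volume := by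
  intro a ha
  rw [show (fun t => (Ioo (-a) a).indicator (groundThetaImage a) t) = (Ioo (-a) a).indicator
    (groundThetaImage a) from rfl, memLp_indicator_iff_restrict measurableSet_Ioo]
  haveI : IsFiniteMeasure (volume.restrict (Ioo (-a) a)) :=
    isFiniteMeasure_restrict.2 measure_Ioo_lt_top.ne
  obtain ⟨K₁, K₂, hA⟩ := exists_abs_groundThetaArchLayer_le a
  obtain ⟨CP, hCP⟩ := exists_abs_groundThetaPrimeLayer_le a a
  have h1 : IntegrableOn (fun t => (a - t) ^ (-(1 / 2) : ℝ)) (Ioo (-a) a) := by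
    have h := (intervalIntegral.intervalIntegrable_rpow' (a := 0) (b := 2 * a)
      (by norm_num : (-1 : ℝ) < -(1 / 2))).comp_sub_left a
    rw [sub_zero, show a - 2 * a = -a by ring] at h
    exact (intervalIntegrable_iff_integrableOn_Ioo_of_le (by linarith)).1 h.symm
  have h2 : IntegrableOn (fun t => (a + t) ^ (-(1 / 2) : ℝ)) (Ioo (-a) a) := by
    have h := (intervalIntegral.intervalIntegrable_rpow' (a := 0) (b := 2 * a)
      (by norm_num : (-1 : ℝ) < -(1 / 2))).comp_add_left a
    rw [zero_sub, show 2 * a - a = a by ring] at h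
    exact (intervalIntegrable_iff_integrableOn_Ioo_of_le (by linarith)).1 h
  have hr1 : MemLp (fun t => (a - t) ^ (-(1 / 4) : ℝ)) 2 (volume.restrict (Ioo (-a) a)) :=
    memLp_rpow_neg_quarter' (u := fun t => a - t) (by fun_prop)
      (fun t ht => show 0 < a - t from sub_pos.2 ht.2) h1
  have hr2 : MemLp (fun t => (a + t) ^ (-(1 / 4) : ℝ)) 2 (volume.restrict (Ioo (-a) a)) :=
    memLp_rpow_neg_quarter' (u := fun t => a + t) (by fun_prop)
      (fun t ht => show 0 < a + t from by linarith [ht.1]) h2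
  have hc : MemLp (fun _ : ℝ => 2 * |groundThetaPolarWeight a| * Real.cosh (a / 2) + CP) 2
      (volume.restrict (Ioo (-a) a)) := memLp_const _
  have hG := (hc.add (hr1.const_mul K₁)).add (hr2.const_mul K₂)
  refine hG.mono' (measurable_groundThetaImage a).aestronglyMeasurable ?_
  filter_upwards [ae_restrict_mem measurableSet_Ioo] with t ht
  have hcs : |Real.cosh (t / 2)| ≤ Real.cosh (a / 2) := by
    rw [abs_of_pos (Real.cosh_pos _), Real.cosh_le_cosh, abs_div, abs_div, abs_two, abs_of_pos ha]
    exact div_le_div_of_nonneg_right (abs_le.2 ⟨ht.1.le, ht.2.le⟩) zero_le_two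
  have hS : |(-(2 * groundThetaPolarWeight a * Real.cosh (t / 2)))| ≤
      2 * |groundThetaPolarWeight a| * Real.cosh (a / 2) := by
    rw [abs_neg, abs_mul, abs_mul, abs_two]
    exact mul_le_mul_of_nonneg_left hcs (by positivity)
  have hP := hCP t (abs_le.2 ⟨ht.1.le, ht.2.le⟩)
  rw [Real.norm_eq_abs, groundThetaImage_def]
  simp only [Pi.add_apply]
  linarith [abs_add_three (-(2 * groundThetaPolarWeight a * Real.cosh (t / 2))) (groundThetaPrimeLayer a t)
    (groundThetaArchLayer a t), hA t ht]

end Summit.RiemannHypothesis.RiemannHypothesis.Theorems.GroundBartaFloor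

end
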